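import Mathlib.NumberTheory.GaussSum
import Mathlib.NumberTheory.LegendreSymbol.QuadraticChar.Basic
import Mathlib.NumberTheory.LegendreSymbol.JacobiSymbol
import Mathlib.NumberTheory.Cyclotomic.Gal
import Literature.NumberTheory.EllipticCurves.KatoTwistedFinitenessTrivialCharacterProofs
import Literature.NumberTheory.EllipticCurves.KatoTwistedFinitenessEulerFactorsProofs
import Literature.NumberTheory.EllipticCurves.KatoTwistedFinitenessDescent
import Literature.NumberTheory.EllipticCurves.QuadraticTwistRank
import Literature.NumberTheory.EllipticCurves.QuadraticTwistKroneckerLFunctionProofs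
import Literature.NumberTheory.EllipticCurves.CuspFormTwist
import Literature.NumberTheory.QuadraticFields.JacobiCharacterPrimitiveProofs
import HarnessLib

/-!
# Kato's Cor. 14.3 (2) at quadratic characters: reduction to the twist over `ℚ`

K. Kato, *`p`-adic Hodge theory and values of zeta functions of modular forms*, Astérisque 295
(2004), Cor. 14.3 (2) (p. 235): for `E/ℚ` modular, `K/ℚ` finite abelian and `χ` a character of
`Gal(K/ℚ)` with `L(E, χ, 1) ≠ 0`, the `χ`-part `E(K)^(χ)` is finite. The tree vendors it for
`K = ℚ(ζ_m)` as the named fact `kato_finite_chiPart_of_twistedLValue_ne_zero`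
(`KatoTwistedFiniteness.lean`), and its `K = ℚ`, `χ = 1` case as bsd.S20
(`kato_finite_of_L_one_ne_zero`, `PAdicBSD.lean`). Kato proves Thm. 14.2 / Cor. 14.3 by first
REDUCING TO `K = ℚ` (14.5–14.7, p. 237: `H¹(K, T) = H¹(ℚ, T ⊗ ℤ[Gal(K/ℚ)])` and
`T ⊗ ℤ[G] ⊗ ℚ ≅ ⊕_χ V(f ⊗ χ⁻¹)`, the twists of `f` by the characters of `G`). For a QUADRATIC
character `χ` the twisted object is again an elliptic curve over `ℚ` — the quadratic twist
`E^{(d)}` — and the reduction can be carried out inside the tree's vocabulary. This file does so,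
for `K = ℚ(ζ_m)` with `m` odd and squarefree and `χ = (·/m)` the Jacobi character mod `m`
(primitive, of conductor `m`; its field is `ℚ(√m*)`, `m* = (−1/m) m ≡ 1 (mod 4)`):

* §§1–3 `exists_sqrt_jacobi_galois` — **`√m* ∈ ℚ(ζ_m)` with Galois action `σ ↦ (a_σ/m)`**:
  `θ = ∏_{p ∣ m} g_p` for the quadratic Gauss sums `g_p = ∑_x (x/p) ζ_p^x` of the primitive
  `p`-th roots `ζ_p = ζ^{m/p}`; `g_p² = (−1/p) p` (Mathlib `gaussSum_sq`) and
  `σ(g_p) = (a_σ/p) g_p` for `σ(ζ) = ζ^{a_σ}` (Mathlib `gaussSum_mulShift_eq`), and the Jacobi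
  symbol is the product of the Legendre symbols (`prod_primeFactors_jacobiSym`); hence
  `θ² = (−1/m) m` and `σ(θ) = (a_σ/m) θ` (Ireland–Rosen, Prop. 6.3.2).
* §4 — `(a_σ/m) = ±1`, it is the value of `cyclotomicCharacterOf (jacobiChar m)` at `σ`, some
  `σ` has `(a_σ/m) = −1` for `m ≠ 1` (`jacobiChar_ne_one`), so `θ ∉ ℚ`.
* §5 `finite_chiPart_of_finite_quadraticTwist` — **`E(ℚ(ζ_m))^(χ) ↪ E^{(m*)}(ℚ)`**: a point
  `P` in the `χ`-part satisfies `σ(P) = χ(σ) P` (`mem_chiPart_iff_of_eq_intCast`); on the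
  completed-square model (`pointEquivBaseChange`, Galois-equivariant) its `x`-coordinate and `y/θ`
  are Galois invariant, hence rational, so `P` is the image of a rational point of the twist under
  the twisting map `τ(X, Y) = (X/m*, Yθ/m*²)` (the tree's `QuadraticDescent.twistMap`,
  Silverman *AEC* X.2, X.5.4, Exercise 10.16). Finiteness of `E^{(m*)}(ℚ)` therefore gives
  finiteness of `E(ℚ(ζ_m))^(χ)`.
* §6 — **`L(E^{(m*)}, s) = L(f, χ, s)`** when `E` has good reduction at the primes of `m`
  (`aₙ(E^{(m*)}) = (n/m) aₙ(E)` for ALL `n`, the tree's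
  `LFunction_quadraticTwist_apply_of_emod_four_eq_one`); it is entire, being the `L`-series of
  the cusp form `f ⊗ χ ∈ S₂(Γ₀(N m²))` (the tree's `charTwist`, `cuspCoeff_charTwist`; Shimura
  1971, Prop. 3.64), so an entire continuation of `∑ χ(n) aₙ n⁻ˢ` non-vanishing at `1` gives
  `L(E^{(m*)}, 1) ≠ 0` (identity theorem).
* §7 `kato_finite_chiPart_jacobiChar_of_kato_finite_of_L_one_ne_zero` — **bsd.S20 for the twists
  implies Kato's Cor. 14.3 (2) over `ℚ(ζ_m)` at `χ = (·/m)`** (`m ≠ 1` odd squarefree, `E` good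
  at the primes of `m`): the statement of `kato_finite_chiPart_of_twistedLValue_ne_zero` at these
  `(m, χ)`, from `kato_finite_of_L_one_ne_zero` applied to `E^{(m*)}`. Together with
  `KatoTwistedFinitenessTrivialCharacterProofs` (the trivial character) this exhibits the part of
  Kato's corollary over `ℚ(ζ_m)` that follows from its `K = ℚ` case — which is also a consequence
  of Gross–Zagier–Kolyvagin, unlike the characters of order `≥ 3`, for which Kato's Euler system
  is the only known road.

* §8 `kato_finite_chiPart_changeLevel_jacobiChar_of_kato_finite_of_L_one_ne_zero` — the same
  over `ℚ(ζ_M)` for every multiple `M` of `m` and the inflated character `χ̃ = changeLevel χ`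
  mod `M` (every quadratic Dirichlet character of odd squarefree conductor `m`, at any level):
  `√m*` is pushed into `ℚ(ζ_M)` along `ℚ(ζ_m) ⊂ ℚ(ζ_M)` (`KatoTwistedFinitenessDescent`), and
  the mod-`M` `L`-hypothesis implies the mod-`m` one (`KatoTwistedFinitenessEulerFactorsProofs`,
  `exists_continuation_of_changeLevel`).

Everything here is a theorem; no definition and no named fact is introduced. Kato's theorem
itself is NOT proved here: bsd.S20 enters as the hypothesis `hS20` of §§7–8.

## Scope (what is not covered)

* Quadratic characters of even conductor (`8 ∣ cond`), and `E` with bad reduction at a prime of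
  `m` (the tree's coefficient formula for the twist assumes good reduction there; in general
  `L(E^{(m*)}, s)` and `L(f, χ, s)` differ by finitely many Euler factors, non-vanishing at
  `s = 1`).
* The Selmer-group clause, part (1) of Cor. 14.3.

## References

* K. Kato, *`p`-adic Hodge theory and values of zeta functions of modular forms*, Astérisque 295
  (2004), 117–290: Thm. 14.2, Cor. 14.3 (p. 235), 14.5–14.7 (p. 237). [Kato2004Asterisque]
* J. H. Silverman, *The Arithmetic of Elliptic Curves*, 2nd ed. (2009), X.2 Prop. 2.4, X.5
  Cor. 5.4, Exercise 10.16. [SilvermanAEC2009]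
* K. Ireland, M. Rosen, *A Classical Introduction to Modern Number Theory*, 2nd ed., GTM 84,
  Prop. 6.3.2 (quadratic Gauss sums), §5.2 (Jacobi symbol).
* G. Shimura, *Introduction to the Arithmetic Theory of Automorphic Functions* (1971), Prop. 3.64,
  Thm. 3.66. [Shimura1971]
-/

noncomputable section

open scoped BigOperators NumberTheorySymbols

open WeierstrassCurve WeierstrassCurve.Affine CongruenceSubgroup Complex

namespace Literature.NumberTheory.EllipticCurves

/-! ## 1. The Jacobi symbol as a product over the prime factors -/

section Jacobi

/-- `J(a | ∏_{p ∈ S} p) = ∏_{p ∈ S} J(a | p)` for a finite set `S` of non-zero naturals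
(multiplicativity of the Jacobi symbol in the denominator, Mathlib `jacobiSym.mul_right'`).
[folklore] -/
theorem jacobiSym_finsetProd (a : ℤ) (S : Finset ℕ) (hS : ∀ p ∈ S, p ≠ 0) :
    J(a | ∏ p ∈ S, p) = ∏ p ∈ S, J(a | p) := by
  classical
  induction S using Finset.induction_on with
  | empty => simp [jacobiSym.one_right]
  | insert q S hq ih =>
    have hS' : ∀ p ∈ S, p ≠ 0 := fun p hp => hS p (Finset.mem_insert_of_mem hp)
    rw [Finset.prod_insert hq, Finset.prod_insert hq,
      jacobiSym.mul_right' a (hS q (Finset.mem_insert_self q S)) (Finset.prod_ne_zero_iff.mpr hS'),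
      ih hS']

/-- For squarefree `b`, `J(a | b) = ∏_{p ∣ b} J(a | p)` (the definition of the Jacobi symbol,
`b = ∏_{p ∣ b} p`). [folklore] -/
theorem prod_primeFactors_jacobiSym {b : ℕ} (hb : Squarefree b) (a : ℤ) :
    ∏ p ∈ b.primeFactors, J(a | p) = J(a | b) := by
  conv_rhs => rw [← Nat.prod_primeFactors_of_squarefree hb]
  exact (jacobiSym_finsetProd a _ fun p hp => (Nat.prime_of_mem_primeFactors hp).ne_zero).symm

end Jacobi

/-! ## 2. Quadratic Gauss sums at a prime, in a field of characteristic zero -/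

section PrimeGauss

variable {K : Type*} [Field K] [CharZero K] {p : ℕ} [Fact p.Prime]

/-- **Galois action on a quadratic Gauss sum.** Let `ζ ∈ K` be a primitive `p`-th root of unity,
`ψ(x) = ζ^x` the additive character of `𝔽_p` it defines and `χ = (·/p)` the quadratic character
(Legendre symbol), `g = ∑_x χ(x) ψ(x)`. A ring endomorphism `σ` of `K` with `σ(ζ) = ζ^a`, `p ∤ a`,
satisfies `σ(g) = (a/p) g`: `σ(g) = ∑ χ(x) ψ(ax) = χ(a)⁻¹ g` (Mathlib `gaussSum_mulShift_eq`) and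
`χ⁻¹ = χ`. (Ireland–Rosen, Prop. 6.3.2; the Galois theory of `ℚ(ζ_p) ⊃ ℚ(√p*)`.) [folklore] -/
theorem ringHom_gaussSum_quadraticChar (σ : K →+* K) {ζ : K} (hζ : IsPrimitiveRoot ζ p) {a : ℕ}
    (hσ : σ ζ = ζ ^ a) (hpa : ¬ p ∣ a) :
    σ (gaussSum ((quadraticChar (ZMod p)).ringHomComp (Int.castRingHom K))
        (AddChar.zmodChar p hζ.pow_eq_one)) =
      (J(a | p) : K) * gaussSum ((quadraticChar (ZMod p)).ringHomComp (Int.castRingHom K))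
        (AddChar.zmodChar p hζ.pow_eq_one) := by
  set χ := (quadraticChar (ZMod p)).ringHomComp (Int.castRingHom K) with hχ
  set ψ := AddChar.zmodChar p hζ.pow_eq_one with hψdef
  have hp : p.Prime := Fact.out
  have hcop : a.Coprime p := Nat.coprime_comm.mp ((Nat.Prime.coprime_iff_not_dvd hp).mpr hpa)
  set u : (ZMod p)ˣ := ZMod.unitOfCoprime a hcop with hu
  have hu' : (u : ZMod p) = a := ZMod.coe_unitOfCoprime a hcop
  -- `σ` acts on `ψ` through `mulShift a`
  have hψ : ∀ x : ZMod p, σ (ψ x) = ψ ((a : ZMod p) * x) := fun x => by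
    rw [hψdef, AddChar.zmodChar_apply, map_pow, hσ, ← pow_mul]
    conv_rhs => rw [← ZMod.natCast_zmod_val x, ← Nat.cast_mul, AddChar.zmodChar_apply']
  -- `σ` fixes the (integer) values of `χ`
  have hχσ : ∀ x : ZMod p, σ (χ x) = χ x := fun x => by
    rw [hχ, MulChar.ringHomComp_apply]
    exact map_intCast σ _
  have h1 : σ (gaussSum χ ψ) = gaussSum χ (ψ.mulShift (u : ZMod p)) := by
    simp only [gaussSum, map_sum, map_mul, hχσ, hψ, AddChar.mulShift_apply, hu']
  rw [h1, gaussSum_mulShift_eq χ ψ u,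
    MulChar.IsQuadratic.inv ((quadraticChar_isQuadratic (ZMod p)).comp _), hu']
  congr 1
  rw [MulChar.ringHomComp_apply, ← jacobiSym.legendreSym.to_jacobiSym, legendreSym, Int.cast_natCast]
  rfl

/-- **The square of the quadratic Gauss sum**: with `ζ`, `ψ`, `χ`, `g` as above and `p` odd,
`g² = (−1/p) p` in `K` (Mathlib `gaussSum_sq`: `χ` is a non-trivial quadratic character and `ψ`
is primitive since `ζ` is a primitive `p`-th root of unity; Ireland–Rosen, Prop. 6.3.2).
[folklore] -/
theorem gaussSum_quadraticChar_sq {ζ : K} (hζ : IsPrimitiveRoot ζ p) (hp2 : p ≠ 2) :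
    gaussSum ((quadraticChar (ZMod p)).ringHomComp (Int.castRingHom K))
        (AddChar.zmodChar p hζ.pow_eq_one) ^ 2 = (J(-1 | p) : K) * p := by
  have hinj : Function.Injective (Int.castRingHom K) := Int.cast_injective
  have hχ1 : (quadraticChar (ZMod p)).ringHomComp (Int.castRingHom K) ≠ 1 :=
    (MulChar.ringHomComp_ne_one_iff hinj).mpr
      (quadraticChar_ne_one (by rwa [ZMod.ringChar_zmod_n]))
  have hχ2 : ((quadraticChar (ZMod p)).ringHomComp (Int.castRingHom K)).IsQuadratic :=
    (quadraticChar_isQuadratic (ZMod p)).comp _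
  have hψ : (AddChar.zmodChar p hζ.pow_eq_one).IsPrimitive :=
    AddChar.zmodChar_primitive_of_primitive_root p hζ
  rw [gaussSum_sq hχ1 hχ2 hψ, ZMod.card, MulChar.ringHomComp_apply]
  congr 1
  rw [← jacobiSym.legendreSym.to_jacobiSym, legendreSym, Int.cast_neg, Int.cast_one]
  rfl

end PrimeGauss

/-! ## 3. `√(±m) ∈ ℚ(ζ_m)` as a product of Gauss sums, with its Galois action -/

section CyclotomicGauss

open IsCyclotomicExtension Polynomial

variable {m : ℕ} [NeZero m]

set_option backward.isDefEq.respectTransparency false in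
/-- `σ ∈ Gal(ℚ(ζ_m)/ℚ)` raises the distinguished primitive root `ζ` to the power
`a_σ = autEquivPow σ ∈ (ℤ/m)ˣ` (Mathlib `IsPrimitiveRoot.autToPow_spec`). [folklore] -/
theorem algEquiv_zeta_eq_pow (σ : CyclotomicField m ℚ ≃ₐ[ℚ] CyclotomicField m ℚ) :
    σ (zeta m ℚ (CyclotomicField m ℚ)) = zeta m ℚ (CyclotomicField m ℚ) ^
      ((autEquivPow (CyclotomicField m ℚ) (cyclotomic.irreducible_rat (NeZero.pos m)) σ :
        (ZMod m)ˣ) : ZMod m).val :=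
  ((zeta_spec m ℚ (CyclotomicField m ℚ)).autToPow_spec ℚ σ).symm

set_option backward.isDefEq.respectTransparency false in
/-- The exponent `a_σ` of `σ ∈ Gal(ℚ(ζ_m)/ℚ)` is prime to `m`. [folklore] -/
theorem coprime_val_autEquivPow (σ : CyclotomicField m ℚ ≃ₐ[ℚ] CyclotomicField m ℚ) :
    (((autEquivPow (CyclotomicField m ℚ) (cyclotomic.irreducible_rat (NeZero.pos m)) σ :
        (ZMod m)ˣ) : ZMod m).val).Coprime m :=
  ZMod.val_coe_unit_coprime _

set_option backward.isDefEq.respectTransparency false in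
/-- **`√m* ∈ ℚ(ζ_m)` for odd squarefree `m`, with its Galois action given by the Jacobi symbol.**
For `m` odd and squarefree there is `θ ∈ ℚ(ζ_m)` with `θ² = m* := (−1/m) m` (`= ±m ≡ 1 mod 4`)
and `σ(θ) = (a_σ/m) θ` for every `σ ∈ Gal(ℚ(ζ_m)/ℚ)`, `σ(ζ) = ζ^{a_σ}`: namely
`θ = ∏_{p ∣ m} g_p`, `g_p = ∑_{x mod p} (x/p) ζ_p^x` the quadratic Gauss sum of the primitive `p`-th
root of unity `ζ_p = ζ^{m/p}`, since `g_p² = (−1/p) p`, `σ(g_p) = (a_σ/p) g_p`, and the Jacobi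
symbol is the product of the Legendre symbols (Ireland–Rosen, Prop. 6.3.2 and §5.2; the quadratic
subfield `ℚ(√m*)` of `ℚ(ζ_m)`). [folklore] -/
theorem exists_sqrt_jacobi_galois (hodd : Odd m) (hsq : Squarefree m) :
    ∃ θ : CyclotomicField m ℚ, θ ^ 2 = (J(-1 | m) : CyclotomicField m ℚ) * m ∧
      ∀ σ : CyclotomicField m ℚ ≃ₐ[ℚ] CyclotomicField m ℚ,
        σ θ = (J((((autEquivPow (CyclotomicField m ℚ) (cyclotomic.irreducible_rat (NeZero.pos m))
          σ : (ZMod m)ˣ) : ZMod m).val : ℤ) | m) : CyclotomicField m ℚ) * θ := by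
  set K := CyclotomicField m ℚ
  set ζ : K := zeta m ℚ K with hζdef
  have hζ : IsPrimitiveRoot ζ m := zeta_spec m ℚ K
  -- the primitive `p`-th roots `ζ_p = ζ^{m/p}` and the prime Gauss sums
  have hζp : ∀ {p : ℕ}, p.Prime → p ∣ m → IsPrimitiveRoot (ζ ^ (m / p)) p := fun hp hpm =>
    hζ.pow (NeZero.pos m) (Nat.div_mul_cancel hpm).symm
  let g : (p : ℕ) → p.Prime → p ∣ m → K := fun p hp hpm =>
    letI : Fact p.Prime := ⟨hp⟩
    gaussSum ((quadraticChar (ZMod p)).ringHomComp (Int.castRingHom K))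
      (AddChar.zmodChar p (hζp hp hpm).pow_eq_one)
  have hmem : ∀ p ∈ m.primeFactors, p.Prime ∧ p ∣ m := fun p hp =>
    ⟨Nat.prime_of_mem_primeFactors hp, Nat.dvd_of_mem_primeFactors hp⟩
  refine ⟨∏ p ∈ m.primeFactors.attach, g p.1 (hmem p.1 p.2).1 (hmem p.1 p.2).2, ?_, ?_⟩
  · -- the square
    have hsqp : ∀ p : m.primeFactors, (g p.1 (hmem p.1 p.2).1 (hmem p.1 p.2).2) ^ 2 =
        (J(-1 | p.1) : K) * (p.1 : ℕ) := fun p => by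
      have hp := (hmem p.1 p.2).1
      letI : Fact p.1.Prime := ⟨hp⟩
      have hp2 : p.1 ≠ 2 := fun h2 => by
        have : 2 ∣ m := h2 ▸ (hmem p.1 p.2).2
        exact (Nat.not_even_iff_odd.mpr hodd) (even_iff_two_dvd.mpr this)
      exact gaussSum_quadraticChar_sq (hζp hp (hmem p.1 p.2).2) hp2
    rw [← Finset.prod_pow, Finset.prod_congr rfl fun p _ => hsqp p, Finset.prod_mul_distrib,
      Finset.prod_attach (s := m.primeFactors) (f := fun p => (J(-1 | p) : K)),
      Finset.prod_attach (s := m.primeFactors) (f := fun p => ((p : ℕ) : K)),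
      ← Int.cast_prod, prod_primeFactors_jacobiSym hsq, ← Nat.cast_prod,
      Nat.prod_primeFactors_of_squarefree hsq]
  · -- the Galois action
    intro σ
    set a : ℕ := ((autEquivPow K (cyclotomic.irreducible_rat (NeZero.pos m)) σ : (ZMod m)ˣ) :
      ZMod m).val with ha
    have hσζ : σ ζ = ζ ^ a := algEquiv_zeta_eq_pow σ
    have hcop : a.Coprime m := coprime_val_autEquivPow σ
    have hgp : ∀ p : m.primeFactors, σ (g p.1 (hmem p.1 p.2).1 (hmem p.1 p.2).2) =
        (J(a | p.1) : K) * g p.1 (hmem p.1 p.2).1 (hmem p.1 p.2).2 := fun p => by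
      have hp := (hmem p.1 p.2).1
      have hpm := (hmem p.1 p.2).2
      letI : Fact p.1.Prime := ⟨hp⟩
      have hσp : (σ : K →+* K) (ζ ^ (m / p.1)) = (ζ ^ (m / p.1)) ^ a := by
        rw [RingHom.coe_coe, map_pow, hσζ, ← pow_mul, ← pow_mul, mul_comm]
      have hpa : ¬ p.1 ∣ a := fun h =>
        hp.one_lt.ne' (Nat.eq_one_of_dvd_coprimes hcop h hpm)
      exact ringHom_gaussSum_quadraticChar (σ : K →+* K) (hζp hp hpm) hσp hpa
    rw [map_prod, Finset.prod_congr rfl fun p _ => hgp p, Finset.prod_mul_distrib,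
      Finset.prod_attach (s := m.primeFactors) (f := fun p => (J(a | p) : K)),
      ← Int.cast_prod, prod_primeFactors_jacobiSym hsq]

end CyclotomicGauss

/-! ## 4. The Jacobi character on `Gal(ℚ(ζ_m)/ℚ)` -/

section JacobiGalois

open IsCyclotomicExtension Polynomial QuadraticFields

variable {m : ℕ} [NeZero m]

set_option backward.isDefEq.respectTransparency false in
/-- `(a_σ/m) = ±1` for `σ ∈ Gal(ℚ(ζ_m)/ℚ)` (`a_σ` is prime to `m`). [folklore] -/
theorem jacobiSym_autEquivPow_eq_one_or (σ : CyclotomicField m ℚ ≃ₐ[ℚ] CyclotomicField m ℚ) :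
    J((((autEquivPow (CyclotomicField m ℚ) (cyclotomic.irreducible_rat (NeZero.pos m)) σ :
        (ZMod m)ˣ) : ZMod m).val : ℤ) | m) = 1 ∨
    J((((autEquivPow (CyclotomicField m ℚ) (cyclotomic.irreducible_rat (NeZero.pos m)) σ :
        (ZMod m)ˣ) : ZMod m).val : ℤ) | m) = -1 := by
  have h0 : J((((autEquivPow (CyclotomicField m ℚ) (cyclotomic.irreducible_rat (NeZero.pos m)) σ :
      (ZMod m)ˣ) : ZMod m).val : ℤ) | m) ≠ 0 := by
    rw [Ne, jacobiSym.eq_zero_iff_not_coprime, not_not, Int.gcd_natCast_natCast]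
    exact coprime_val_autEquivPow σ
  rcases jacobiSym.trichotomy ((((autEquivPow (CyclotomicField m ℚ)
      (cyclotomic.irreducible_rat (NeZero.pos m)) σ : (ZMod m)ˣ) : ZMod m).val : ℤ)) m with
    h | h | h
  · exact (h0 h).elim
  · exact Or.inl h
  · exact Or.inr h

set_option backward.isDefEq.respectTransparency false in
/-- The character of `Gal(ℚ(ζ_m)/ℚ)` attached (`cyclotomicCharacterOf`) to the Jacobi character
`(·/m)` mod `m` (the tree's `jacobiChar m`) is `σ ↦ (a_σ/m)`. [folklore] -/
theorem coe_cyclotomicCharacterOf_jacobiChar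
    (σ : CyclotomicField m ℚ ≃ₐ[ℚ] CyclotomicField m ℚ) :
    (cyclotomicCharacterOf (jacobiChar m) σ : ℂ) =
      (J((((autEquivPow (CyclotomicField m ℚ) (cyclotomic.irreducible_rat (NeZero.pos m)) σ :
        (ZMod m)ˣ) : ZMod m).val : ℤ) | m) : ℂ) := by
  rw [coe_cyclotomicCharacterOf_apply, jacobiChar_apply]

set_option backward.isDefEq.respectTransparency false in
/-- For `m` odd, squarefree and `≠ 1` some `σ ∈ Gal(ℚ(ζ_m)/ℚ)` has `(a_σ/m) = −1` (the Jacobi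
character mod `m` is non-trivial, the tree's `jacobiChar_ne_one`, and `autEquivPow` is onto
`(ℤ/m)ˣ`). [folklore] -/
theorem exists_algEquiv_jacobiSym_eq_neg_one (hodd : Odd m) (hsq : Squarefree m) (hm1 : m ≠ 1) :
    ∃ σ : CyclotomicField m ℚ ≃ₐ[ℚ] CyclotomicField m ℚ,
      J((((autEquivPow (CyclotomicField m ℚ) (cyclotomic.irreducible_rat (NeZero.pos m)) σ :
        (ZMod m)ˣ) : ZMod m).val : ℤ) | m) = -1 := by
  obtain ⟨u, hu⟩ := MulChar.ne_one_iff.mp (jacobiChar_ne_one hodd hsq hm1)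
  refine ⟨(autEquivPow (CyclotomicField m ℚ) (cyclotomic.irreducible_rat (NeZero.pos m))).symm u,
    ?_⟩
  rw [MulEquiv.apply_symm_apply]
  have h0 : J((((u : ZMod m)).val : ℤ) | m) ≠ 0 := by
    rw [Ne, jacobiSym.eq_zero_iff_not_coprime, not_not, Int.gcd_natCast_natCast]
    exact ZMod.val_coe_unit_coprime u
  have h1 : J((((u : ZMod m)).val : ℤ) | m) ≠ 1 := fun h =>
    hu (by rw [jacobiChar_apply, h, Int.cast_one])
  rcases jacobiSym.trichotomy ((((u : ZMod m)).val : ℤ)) m with h | h | h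
  · exact (h0 h).elim
  · exact (h1 h).elim
  · exact h

set_option backward.isDefEq.respectTransparency false in
/-- An element `θ ≠ 0` of `ℚ(ζ_m)` on which `Gal(ℚ(ζ_m)/ℚ)` acts through `(a_σ/m)` is irrational
when `m ≠ 1` is odd and squarefree: some `σ` negates it. [folklore] -/
theorem not_mem_range_of_jacobi_galois (hodd : Odd m) (hsq : Squarefree m) (hm1 : m ≠ 1)
    {θ : CyclotomicField m ℚ} (hθ0 : θ ≠ 0)
    (hθσ : ∀ σ : CyclotomicField m ℚ ≃ₐ[ℚ] CyclotomicField m ℚ,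
      σ θ = (J((((autEquivPow (CyclotomicField m ℚ) (cyclotomic.irreducible_rat (NeZero.pos m))
        σ : (ZMod m)ˣ) : ZMod m).val : ℤ) | m) : CyclotomicField m ℚ) * θ) :
    θ ∉ Set.range (algebraMap ℚ (CyclotomicField m ℚ)) := by
  obtain ⟨σ, hσ⟩ := exists_algEquiv_jacobiSym_eq_neg_one hodd hsq hm1
  rintro ⟨q, hq⟩
  have h := hθσ σ
  rw [hσ, ← hq, AlgEquiv.commutes, Int.cast_neg, Int.cast_one, neg_one_mul] at h
  exact hθ0 (hq ▸ CharZero.eq_neg_self_iff.mp h)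

end JacobiGalois

/-! ## 5. The `χ`-eigenspace of `E(ℚ(ζ_m))` for a quadratic `χ` embeds into the twist over `ℚ` -/

section Points

open QuadraticDescent

variable {m : ℕ} [DecidableEq (CyclotomicField m ℚ)]

/-- Transport along an equality of Weierstrass equations over `ℚ` commutes with the Galois
action on `ℚ(ζ_m)`-points. [folklore] -/
theorem congrEquiv_baseChange_map {W₁ W₂ : WeierstrassCurve ℚ} (h : W₁ = W₂)
    (σ : CyclotomicField m ℚ →ₐ[ℚ] CyclotomicField m ℚ)
    (P : (W₁.baseChange (CyclotomicField m ℚ)).toAffine.Point) :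
    Affine.Point.congrEquiv
        (congrArg (fun V : WeierstrassCurve ℚ => V.baseChange (CyclotomicField m ℚ)) h)
        (Point.map (W' := W₁.toAffine) σ P) =
      Point.map (W' := W₂.toAffine) σ (Affine.Point.congrEquiv
        (congrArg (fun V : WeierstrassCurve ℚ => V.baseChange (CyclotomicField m ℚ)) h) P) := by
  subst h
  rfl

set_option backward.isDefEq.respectTransparency false in
/-- **Eigenvectors of a quadratic Galois character come from the twist** (Silverman *AEC* X.2,
proof of Prop. 2.4; the pointwise heart of Kato's reduction 14.6 to `K = ℚ` for a quadratic
character). Let `θ ∈ ℚ(ζ_m)`, `θ ∉ ℚ`, `θ² = d ∈ ℚ`, and let `Gal(ℚ(ζ_m)/ℚ)` act on `θ` through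
`c = ±1`: `σ(θ) = c(σ) θ`. If a point `Q` of the completed-square model `W^{(1)}` of `W/ℚ` over
`ℚ(ζ_m)` satisfies `σ(Q) = c(σ) Q` for all `σ`, then `Q = τ(R)` for a point `R ∈ W^{(d)}(ℚ)` of the
quadratic twist and the twisting map `τ(X, Y) = (X/d, Yθ/d²)` (the tree's `twistMap`): the
`x`-coordinate of `Q` and `y/θ` are Galois invariant, hence rational (`ℚ(ζ_m)/ℚ` is Galois).
[cite: SilvermanAEC2009, X.5 Cor. 5.4] -/
theorem exists_twistMap_eq_of_forall_map_eq (W : WeierstrassCurve ℚ) {θ : CyclotomicField m ℚ}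
    {d : ℚ} (hθ : θ ∉ Set.range (algebraMap ℚ (CyclotomicField m ℚ)))
    (hd : θ ^ 2 = algebraMap ℚ (CyclotomicField m ℚ) d)
    {c : (CyclotomicField m ℚ ≃ₐ[ℚ] CyclotomicField m ℚ) → ℤ} (hc : ∀ σ, c σ = 1 ∨ c σ = -1)
    (hcθ : ∀ σ, σ θ = (c σ : CyclotomicField m ℚ) * θ)
    {Q : ((W.quadraticTwist 1).baseChange (CyclotomicField m ℚ)).toAffine.Point}
    (hQ : ∀ σ : CyclotomicField m ℚ ≃ₐ[ℚ] CyclotomicField m ℚ,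
      Point.map (W' := (W.quadraticTwist 1).toAffine)
        (σ : CyclotomicField m ℚ →ₐ[ℚ] CyclotomicField m ℚ) Q = c σ • Q) :
    ∃ R : (W.quadraticTwist d).toAffine.Point, twistMap W hθ hd R = Q := by
  haveI : IsGalois ℚ (CyclotomicField m ℚ) := IsCyclotomicExtension.isGalois {m} ℚ _
  have hθ0 : θ ≠ 0 :=
    Literature.NumberTheory.QuadraticFields.Quadratic.ne_zero_of_not_mem_range hθ
  rcases Q with _ | ⟨x, y, h⟩
  · exact ⟨0, (map_zero _).trans Affine.Point.zero_def⟩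
  · have hxy : ∀ σ : CyclotomicField m ℚ ≃ₐ[ℚ] CyclotomicField m ℚ,
        σ x = x ∧ σ y = (c σ : CyclotomicField m ℚ) * y := fun σ => by
      have e := hQ σ
      rw [Affine.Point.map_some] at e
      rcases hc σ with h1 | h1
      · rw [h1, one_zsmul, Affine.Point.some.injEq] at e
        refine ⟨e.1, ?_⟩
        rw [h1, Int.cast_one, one_mul]
        exact e.2
      · rw [h1, neg_one_zsmul, Affine.Point.neg_some, Affine.Point.some.injEq,
          negY_quadraticTwist_one_baseChange] at e
        refine ⟨e.1, ?_⟩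
        rw [h1, Int.cast_neg, Int.cast_one, neg_one_mul]
        exact e.2
    obtain ⟨a, ha⟩ := (IsGalois.mem_range_algebraMap_iff_fixed x).mpr fun σ => (hxy σ).1
    have hyθ : ∀ σ : CyclotomicField m ℚ ≃ₐ[ℚ] CyclotomicField m ℚ, σ (y * θ⁻¹) = y * θ⁻¹ :=
      fun σ => by
        rw [map_mul, map_inv₀, (hxy σ).2, hcθ σ]
        rcases hc σ with h1 | h1
        · rw [h1, Int.cast_one, one_mul, one_mul]
        · rw [h1, Int.cast_neg, Int.cast_one, neg_one_mul, neg_one_mul, inv_neg, mul_neg,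
            neg_mul, neg_neg]
    obtain ⟨b, hb⟩ := (IsGalois.mem_range_algebraMap_iff_fixed (y * θ⁻¹)).mpr hyθ
    have hb' : algebraMap ℚ (CyclotomicField m ℚ) b * θ = y := by
      rw [hb, inv_mul_cancel_right₀ hθ0]
    exact exists_twistMap_eq W hθ hd h ha hb'

/-- **`E(ℚ(ζ_m))^(χ) ↪ E^{(d)}(ℚ)` for a quadratic character `χ`: finiteness descends from the
twist.** With `θ`, `d`, `c` as above (and `Aut` acting on `θ` through `c`), let `χ : Gal → ℂ` be
the character `σ ↦ c(σ)`. If the Mordell–Weil group `E^{(d)}(ℚ)` of the quadratic twist is finite,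
then Kato's `χ`-part `E(ℚ(ζ_m))^(χ)` is finite: `E(ℚ(ζ_m))^(χ)` is the `c`-eigenspace
(`mem_chiPart_iff_of_eq_intCast`), which the change of variables to the completed-square model
(`pointEquivBaseChange`, Galois equivariant) followed by the inverse of the twisting map embeds
into `E^{(d)}(ℚ)` (`exists_twistMap_eq_of_forall_map_eq`). This is the algebraic half of Kato's
reduction of Cor. 14.3 to `K = ℚ` (Astérisque 295, 14.6) for quadratic characters, where the
twisted object `E ⊗ χ` is again an elliptic curve over `ℚ`. [cite: Kato2004Asterisque, §14.6] -/
theorem finite_chiPart_of_finite_quadraticTwist (W : WeierstrassCurve ℚ)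
    {θ : CyclotomicField m ℚ} {d : ℚ} (hθ : θ ∉ Set.range (algebraMap ℚ (CyclotomicField m ℚ)))
    (hd : θ ^ 2 = algebraMap ℚ (CyclotomicField m ℚ) d)
    {c : (CyclotomicField m ℚ ≃ₐ[ℚ] CyclotomicField m ℚ) → ℤ} (hc : ∀ σ, c σ = 1 ∨ c σ = -1)
    (hcθ : ∀ σ, σ θ = (c σ : CyclotomicField m ℚ) * θ)
    {χ : (CyclotomicField m ℚ ≃ₐ[ℚ] CyclotomicField m ℚ) → ℂ} (hχ : ∀ σ, χ σ = c σ)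
    (hfin : Finite (W.quadraticTwist d).toAffine.Point) :
    Finite (chiPart
      (fun σ : CyclotomicField m ℚ ≃ₐ[ℚ] CyclotomicField m ℚ =>
        Point.map (W' := W.toAffine) (σ : CyclotomicField m ℚ →ₐ[ℚ] CyclotomicField m ℚ)) χ) := by
  have hθ0 : θ ≠ 0 :=
    Literature.NumberTheory.QuadraticFields.Quadratic.ne_zero_of_not_mem_range hθ
  -- `c 1 = 1`
  have hc1 : c 1 = 1 := by
    have h := hcθ 1
    rw [AlgEquiv.one_apply] at h
    have h' : ((c 1 : ℤ) : CyclotomicField m ℚ) = 1 := by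
      have := mul_right_cancel₀ hθ0 (h.symm.trans (one_mul θ).symm)
      exact this
    exact_mod_cast h'
  obtain ⟨C, hC⟩ := W.exists_variableChange_quadraticTwist_one
  set ρ : (CyclotomicField m ℚ ≃ₐ[ℚ] CyclotomicField m ℚ) →
      (W.baseChange (CyclotomicField m ℚ)).toAffine.Point →+
        (W.baseChange (CyclotomicField m ℚ)).toAffine.Point :=
    fun σ => Point.map (W' := W.toAffine) (σ : CyclotomicField m ℚ →ₐ[ℚ] CyclotomicField m ℚ)
    with hρ
  -- the eigen-relation on `E(ℚ(ζ_m))^(χ)`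
  have heig : ∀ P ∈ chiPart ρ χ, ∀ σ, ρ σ P = c σ • P := fun P hP =>
    (mem_chiPart_iff_of_eq_intCast (ρ := ρ) (fun Q => by rcases Q with _ | ⟨x, y, h⟩ <;> rfl)
      hχ hc1 P).mp hP
  -- transported to the completed-square model
  have hQ : ∀ P ∈ chiPart ρ χ, ∀ σ : CyclotomicField m ℚ ≃ₐ[ℚ] CyclotomicField m ℚ,
      Point.map (W' := (W.quadraticTwist 1).toAffine)
        (σ : CyclotomicField m ℚ →ₐ[ℚ] CyclotomicField m ℚ)
        (Affine.Point.congrEquiv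
          (congrArg (fun V : WeierstrassCurve ℚ => V.baseChange (CyclotomicField m ℚ)) hC)
          (VariableChange.pointEquivBaseChange W C (CyclotomicField m ℚ) P)) =
      c σ • Affine.Point.congrEquiv
          (congrArg (fun V : WeierstrassCurve ℚ => V.baseChange (CyclotomicField m ℚ)) hC)
          (VariableChange.pointEquivBaseChange W C (CyclotomicField m ℚ) P) := by
    intro P hP σ
    rw [← congrEquiv_baseChange_map hC, ← VariableChange.pointEquivBaseChange_map_algEquiv]
    have h := heig P hP σ
    simp only [hρ] at h
    rw [h, map_zsmul, map_zsmul]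
  choose R hR using fun P : chiPart ρ χ =>
    exists_twistMap_eq_of_forall_map_eq W hθ hd hc hcθ (hQ P.1 P.2)
  haveI := hfin
  refine Finite.of_injective R fun P₁ P₂ h => ?_
  have h' := (hR P₁).symm.trans ((congrArg _ h).trans (hR P₂))
  exact Subtype.ext ((VariableChange.pointEquivBaseChange W C (CyclotomicField m ℚ)).injective
    ((Affine.Point.congrEquiv _).injective h'))

end Points

/-! ## 6. `L(E^{(m*)}, s) = L(f, χ_m, s)`: the twist over `ℚ` is the twisted `L`-function -/

section LSide

open ModularForms QuadraticFields

variable {N : ℕ} [NeZero N] {m : ℕ} [NeZero m]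

omit [NeZero N] [NeZero m] in
/-- If the Dirichlet coefficients of `W'/ℚ` are `χ(n) aₙ(f)` then `L(W', s) = L(f, χ, s)` as
Dirichlet series (every `s`). [folklore] -/
theorem LSeries_eq_twistedLSeries_of_coeff (W' : WeierstrassCurve ℚ) (f : CuspForm (Gamma0 N) 2)
    (χ : DirichletCharacter ℂ m) (hco : ∀ n : ℕ, ((W'.LFunction n : ℤ) : ℂ) = χ n * cuspCoeff f n)
    (s : ℂ) : W'.LSeries s = twistedLSeries f χ s := by
  unfold WeierstrassCurve.LSeries twistedLSeries
  congr 1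
  funext n
  exact hco n

/-- **`L(W', s)` is entire when `aₙ(W') = (n/m) aₙ(f)`** for `f ∈ S₂(Γ₀(N))` and `m` odd
squarefree: the coefficients are those of the quadratic twist `f ⊗ χ_m ∈ S₂(Γ₀(N m²))`
(`charTwist`, `cuspCoeff_charTwist`: `χ_m = (·/m)` is primitive and quadratic; Shimura 1971,
Prop. 3.64), and the `L`-series of a weight-`2` cusp form is entire
(`hasEntireLFunction_of_cuspCoeff_eq`, Hecke). [cite: Shimura1971, Prop. 3.64] -/
theorem hasEntireLFunction_of_coeff_jacobiChar (W' : WeierstrassCurve ℚ)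
    (f : CuspForm (Gamma0 N) 2) (hodd : Odd m) (hsq : Squarefree m)
    (hco : ∀ n : ℕ, ((W'.LFunction n : ℤ) : ℂ) = jacobiChar m n * cuspCoeff f n) :
    W'.HasEntireLFunction := by
  have hN : N ∣ N * m ^ 2 := dvd_mul_right N _
  have hm : m ^ 2 ∣ N * m ^ 2 := dvd_mul_left _ _
  haveI : NeZero (N * m ^ 2) := ⟨mul_ne_zero (NeZero.ne N) (pow_ne_zero 2 (NeZero.ne m))⟩
  exact W'.hasEntireLFunction_of_cuspCoeff_eq (strictWidthInfty_Gamma0 (N * m ^ 2))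
    (charTwist (N * m ^ 2) hN hm isQuadratic_jacobiChar f) fun n => by
      rw [cuspCoeff_charTwist (N * m ^ 2) hN hm isQuadratic_jacobiChar
        (isPrimitive_jacobiChar hodd hsq) f n, hco n]

omit [NeZero N] [NeZero m] in
/-- **`L(f, χ, 1) ≠ 0 ⇒ L(W', 1) ≠ 0`** when `aₙ(W') = χ(n) aₙ(f)` and `L(W', s)` is entire: an
entire continuation of `∑ χ(n) aₙ(f) n⁻ˢ` (`re s > 2`) IS `W'.entireLFunction` by the identity
theorem. [folklore] -/
theorem entireLFunction_one_ne_zero_of_twistedLSeries (W' : WeierstrassCurve ℚ)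
    (hE : W'.HasEntireLFunction) (f : CuspForm (Gamma0 N) 2) (χ : DirichletCharacter ℂ m)
    (hco : ∀ n : ℕ, ((W'.LFunction n : ℤ) : ℂ) = χ n * cuspCoeff f n)
    (hL : ∃ L : ℂ → ℂ, Differentiable ℂ L ∧
      (∀ s : ℂ, 2 < s.re → L s = twistedLSeries f χ s) ∧ L 1 ≠ 0) :
    W'.entireLFunction 1 ≠ 0 := by
  obtain ⟨L, hLd, hLs, hL1⟩ := hL
  have hLE : L = W'.entireLFunction := by
    refine AnalyticOnNhd.eq_of_eventuallyEq (z₀ := (3 : ℂ))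
      (hLd.differentiableOn.analyticOnNhd isOpen_univ)
      ((W'.differentiable_entireLFunction hE).differentiableOn.analyticOnNhd isOpen_univ) ?_
    have hopen : IsOpen {s : ℂ | 2 < s.re} := isOpen_lt continuous_const Complex.continuous_re
    have hmem : (3 : ℂ) ∈ {s : ℂ | 2 < s.re} := by simp; norm_num
    filter_upwards [hopen.mem_nhds hmem] with s hs
    have hs' : (3 / 2 : ℝ) < s.re := by
      have : (2 : ℝ) < s.re := hs
      linarith
    rw [hLs s hs, W'.entireLFunction_eq_LSeries hE hs', LSeries_eq_twistedLSeries_of_coeff W' f χ hco]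
  rw [← hLE]
  exact hL1

end LSide

/-! ## 7. Kato's Cor. 14.3 (2) at the Jacobi character from the `K = ℚ` case of the twist -/

section Assembly

open ModularForms QuadraticFields IsCyclotomicExtension Polynomial IsDedekindDomain NumberField
  Rat.HeightOneSpectrum

variable {m : ℕ} [NeZero m]

/-- `m* = (−1/m) m` for odd `m`: `(−1/m) = ±1`, `m* ≡ 1 (mod 4)`, `|m*| = m`. [folklore] -/
theorem jacobiSym_neg_one_mul_self (hodd : Odd m) :
    (J(-1 | m) * m : ℤ) % 4 = 1 ∧ (J(-1 | m) * m : ℤ).natAbs = m := by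
  rw [jacobiSym.at_neg_one hodd]
  obtain ⟨k, rfl⟩ := hodd
  rcases Nat.even_or_odd k with ⟨j, rfl⟩ | ⟨j, rfl⟩
  · have h1 : (2 * (j + j) + 1) % 4 = 1 := by omega
    rw [ZMod.χ₄_nat_one_mod_four h1, one_mul]
    exact ⟨by omega, Int.natAbs_natCast _⟩
  · have h3 : (2 * (2 * j + 1) + 1) % 4 = 3 := by omega
    rw [ZMod.χ₄_nat_three_mod_four h3]
    refine ⟨by omega, ?_⟩
    rw [neg_one_mul, Int.natAbs_neg, Int.natAbs_natCast]

set_option backward.isDefEq.respectTransparency false in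
/-- **Kato's Cor. 14.3 (2) over `ℚ(ζ_m)` at the quadratic character `(·/m)`, from the `K = ℚ`
case applied to the quadratic twist** (Kato, Astérisque 295, reduction 14.6 of Thm. 14.2 to
`K = ℚ`, in the one case where the twisted object is again an elliptic curve over `ℚ`). Assume
`kato_finite_of_L_one_ne_zero V p` (bsd.S20: `L(V, 1) ≠ 0 ⇒ V(ℚ)` finite, Kato Cor. 14.3 with
`K = ℚ`, `χ = 1`; equally a consequence of Gross–Zagier–Kolyvagin) for every elliptic `V/ℚ` and
prime `p`. Let `E/ℚ` be an elliptic curve (model `W`) with newform `f` (`IsNewformOf W f`),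
`m ≠ 1` odd and squarefree with `E` of good reduction at the primes dividing `m`, `K = ℚ(ζ_m)`,
and `χ = (·/m)` the Jacobi character mod `m` (primitive, quadratic, of conductor `m`), read on
`Gal(K/ℚ)` as `σ ↦ (a_σ/m)`. If `L_{prime(m)}(f, χ, s) = ∑ χ(n) aₙ n⁻ˢ` has an entire
continuation non-vanishing at `s = 1`, then `E(K)^(χ)` is finite. Proof: with
`m* = (−1/m) m ≡ 1 (mod 4)`, `aₙ(E^{(m*)}) = χ(n) aₙ(E)` for all `n`
(`LFunction_quadraticTwist_apply_of_emod_four_eq_one`), so `L(E^{(m*)}, s) = L(f, χ, s)` is entire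
(`f ⊗ χ ∈ S₂(Γ₀(N m²))`) and `L(E^{(m*)}, 1) ≠ 0`; bsd.S20 makes `E^{(m*)}(ℚ)` finite; and
`E(K)^(χ) ↪ E^{(m*)}(ℚ)` through `√m* = ∏_{p ∣ m} g_p ∈ K` (`exists_sqrt_jacobi_galois`,
`finite_chiPart_of_finite_quadraticTwist`). [cite: Kato2004Asterisque, Cor. 14.3 (2) (p. 235)] -/
theorem kato_finite_chiPart_jacobiChar_of_kato_finite_of_L_one_ne_zero
    (hS20 : ∀ (V : WeierstrassCurve ℚ) [V.IsElliptic] (p : ℕ) [Fact p.Prime],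
      kato_finite_of_L_one_ne_zero V p)
    (W : WeierstrassCurve ℚ) [W.IsElliptic] {N : ℕ} [NeZero N] {f : CuspForm (Gamma0 N) 2}
    (hf : IsNewformOf W f) [DecidableEq (CyclotomicField m ℚ)] (hodd : Odd m)
    (hsq : Squarefree m) (hm1 : m ≠ 1)
    (hgood : ∀ v : HeightOneSpectrum (𝓞 ℚ), (primesEquiv v : ℕ) ∣ m → W.HasGoodReductionAt v)
    (hL : ∃ L : ℂ → ℂ, Differentiable ℂ L ∧
      (∀ s : ℂ, 2 < s.re → L s = twistedLSeries f (jacobiChar m) s) ∧ L 1 ≠ 0) :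
    Finite (chiPart
      (fun σ : CyclotomicField m ℚ ≃ₐ[ℚ] CyclotomicField m ℚ =>
        Point.map (W' := W.toAffine) (σ : CyclotomicField m ℚ →ₐ[ℚ] CyclotomicField m ℚ))
      (fun σ => (cyclotomicCharacterOf (jacobiChar m) σ : ℂ))) := by
  -- the twisting discriminant `D = m*`
  set D : ℤ := J(-1 | m) * m with hDdef
  obtain ⟨hD4, hDabs⟩ := jacobiSym_neg_one_mul_self (m := m) hodd
  rw [← hDdef] at hD4 hDabs
  have hD0 : D ≠ 0 := fun h => NeZero.ne m (by rw [← hDabs, h, Int.natAbs_zero])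
  have hDq : (D : ℚ) ≠ 0 := by exact_mod_cast hD0
  have hsqD : Squarefree D := Int.squarefree_natAbs.mp (hDabs ▸ hsq)
  haveI : (W.quadraticTwist (D : ℚ)).IsElliptic := W.isElliptic_quadraticTwist hDq
  -- the Dirichlet coefficients of the twist
  have hco : ∀ n : ℕ, (((W.quadraticTwist (D : ℚ)).LFunction n : ℤ) : ℂ) =
      jacobiChar m n * cuspCoeff f n := fun n => by
    rw [W.LFunction_quadraticTwist_apply_of_emod_four_eq_one hD4 hsqD (fun v hv => hgood v ?_) n,
      Int.cast_mul, hDabs, jacobiChar_natCast, hf.2 n]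
    rw [← hDabs]
    exact Int.natCast_dvd.mp hv
  -- `L(E^{(D)}, 1) ≠ 0`, hence `E^{(D)}(ℚ)` finite by bsd.S20
  have hE := hasEntireLFunction_of_coeff_jacobiChar _ f hodd hsq hco
  have h1 : (W.quadraticTwist (D : ℚ)).entireLFunction 1 ≠ 0 :=
    entireLFunction_one_ne_zero_of_twistedLSeries _ hE f _ hco hL
  haveI : Fact (Nat.Prime 2) := ⟨Nat.prime_two⟩
  have hfin : Finite (W.quadraticTwist (D : ℚ)).toAffine.Point := (hS20 _ 2 h1).1
  -- `√D ∈ ℚ(ζ_m)` and its Galois action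
  obtain ⟨θ, hθ2, hθσ⟩ := exists_sqrt_jacobi_galois (m := m) hodd hsq
  have hd : θ ^ 2 = algebraMap ℚ (CyclotomicField m ℚ) (D : ℚ) := by
    rw [hθ2, hDdef, Int.cast_mul, map_mul, map_intCast, Int.cast_natCast, map_natCast]
  have hθ0 : θ ≠ 0 := fun h0 => by
    rw [h0, zero_pow two_ne_zero, eq_comm, map_eq_zero] at hd
    exact hDq hd
  have hθ : θ ∉ Set.range (algebraMap ℚ (CyclotomicField m ℚ)) :=
    not_mem_range_of_jacobi_galois hodd hsq hm1 hθ0 hθσ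
  exact finite_chiPart_of_finite_quadraticTwist W hθ hd jacobiSym_autEquivPow_eq_one_or hθσ
    coe_cyclotomicCharacterOf_jacobiChar hfin

end Assembly

/-! ## 8. Every level `M` divisible by `m`: the inflated quadratic characters -/

section Inflation

open ModularForms QuadraticFields IsCyclotomicExtension Polynomial IsDedekindDomain NumberField
  Rat.HeightOneSpectrum

variable {m M : ℕ} [NeZero m] [NeZero M]

set_option backward.isDefEq.respectTransparency false in
/-- **`L(f, χ_m, 1) ≠ 0 ⇒ E^{(m*)}(ℚ)` finite, given bsd.S20** (the analytic half of §7 isolated):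
for `E/ℚ` elliptic with newform `f`, `m` odd squarefree with `E` good at the primes of `m`, and an
entire continuation of `∑ (n/m) aₙ n⁻ˢ` non-vanishing at `1`, the Mordell–Weil group of the
quadratic twist `E^{(m*)}`, `m* = (−1/m) m`, is finite (`kato_finite_of_L_one_ne_zero` for
`E^{(m*)}` at `p = 2`, its hypothesis `L(E^{(m*)}, 1) ≠ 0` coming from
`L(E^{(m*)}, s) = L(f, χ_m, s)`). [cite: Kato2004Asterisque, Cor. 14.3 (2) (p. 235)] -/
theorem finite_point_quadraticTwist_of_twistedLValue_ne_zero
    (hS20 : ∀ (V : WeierstrassCurve ℚ) [V.IsElliptic] (p : ℕ) [Fact p.Prime],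
      kato_finite_of_L_one_ne_zero V p)
    (W : WeierstrassCurve ℚ) [W.IsElliptic] {N : ℕ} [NeZero N] {f : CuspForm (Gamma0 N) 2}
    (hf : IsNewformOf W f) (hodd : Odd m) (hsq : Squarefree m)
    (hgood : ∀ v : HeightOneSpectrum (𝓞 ℚ), (primesEquiv v : ℕ) ∣ m → W.HasGoodReductionAt v)
    (hL : ∃ L : ℂ → ℂ, Differentiable ℂ L ∧
      (∀ s : ℂ, 2 < s.re → L s = twistedLSeries f (jacobiChar m) s) ∧ L 1 ≠ 0) :
    Finite (W.quadraticTwist ((J(-1 | m) * m : ℤ) : ℚ)).toAffine.Point := by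
  set D : ℤ := J(-1 | m) * m with hDdef
  obtain ⟨hD4, hDabs⟩ := jacobiSym_neg_one_mul_self (m := m) hodd
  rw [← hDdef] at hD4 hDabs
  have hD0 : D ≠ 0 := fun h => NeZero.ne m (by rw [← hDabs, h, Int.natAbs_zero])
  have hDq : (D : ℚ) ≠ 0 := by exact_mod_cast hD0
  have hsqD : Squarefree D := Int.squarefree_natAbs.mp (hDabs ▸ hsq)
  haveI : (W.quadraticTwist (D : ℚ)).IsElliptic := W.isElliptic_quadraticTwist hDq
  have hco : ∀ n : ℕ, (((W.quadraticTwist (D : ℚ)).LFunction n : ℤ) : ℂ) =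
      jacobiChar m n * cuspCoeff f n := fun n => by
    rw [W.LFunction_quadraticTwist_apply_of_emod_four_eq_one hD4 hsqD (fun v hv => hgood v ?_) n,
      Int.cast_mul, hDabs, jacobiChar_natCast, hf.2 n]
    rw [← hDabs]
    exact Int.natCast_dvd.mp hv
  have hE := hasEntireLFunction_of_coeff_jacobiChar _ f hodd hsq hco
  have h1 : (W.quadraticTwist (D : ℚ)).entireLFunction 1 ≠ 0 :=
    entireLFunction_one_ne_zero_of_twistedLSeries _ hE f _ hco hL
  haveI : Fact (Nat.Prime 2) := ⟨Nat.prime_two⟩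
  exact (hS20 _ 2 h1).1

set_option backward.isDefEq.respectTransparency false in
/-- Restriction to `ℚ(ζ_m)` does not change the Jacobi symbol of the cyclotomic exponent:
for `m ∣ M` and `σ ∈ Gal(ℚ(ζ_M)/ℚ)`, `(a_{σ|ℚ(ζ_m)}/m) = (a_σ/m)` (`a_{σ|} ≡ a_σ (mod m)`,
`unitsMap_autEquivPow_eq_autEquivPow_restrictNormal`). [folklore] -/
theorem jacobiSym_autEquivPow_restrictNormal (hd : m ∣ M)
    (ι : CyclotomicField m ℚ →ₐ[ℚ] CyclotomicField M ℚ)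
    (σ : CyclotomicField M ℚ ≃ₐ[ℚ] CyclotomicField M ℚ) :
    letI : Algebra (CyclotomicField m ℚ) (CyclotomicField M ℚ) := ι.toRingHom.toAlgebra
    haveI : IsScalarTower ℚ (CyclotomicField m ℚ) (CyclotomicField M ℚ) :=
      IsScalarTower.of_algebraMap_eq fun x => (ι.commutes x).symm
    haveI : IsGalois ℚ (CyclotomicField m ℚ) := IsCyclotomicExtension.isGalois {m} ℚ _
    J((((autEquivPow (CyclotomicField m ℚ) (cyclotomic.irreducible_rat (NeZero.pos m))
        (σ.restrictNormal (CyclotomicField m ℚ)) : (ZMod m)ˣ) : ZMod m).val : ℤ) | m) =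
      J((((autEquivPow (CyclotomicField M ℚ) (cyclotomic.irreducible_rat (NeZero.pos M)) σ :
        (ZMod M)ˣ) : ZMod M).val : ℤ) | m) := by
  letI : Algebra (CyclotomicField m ℚ) (CyclotomicField M ℚ) := ι.toRingHom.toAlgebra
  haveI : IsScalarTower ℚ (CyclotomicField m ℚ) (CyclotomicField M ℚ) :=
    IsScalarTower.of_algebraMap_eq fun x => (ι.commutes x).symm
  haveI : IsGalois ℚ (CyclotomicField m ℚ) := IsCyclotomicExtension.isGalois {m} ℚ _
  rw [← unitsMap_autEquivPow_eq_autEquivPow_restrictNormal hd ι σ, ZMod.unitsMap_val,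
    ZMod.cast_eq_val, ZMod.val_natCast, jacobiSym_natCast_mod]

set_option backward.isDefEq.respectTransparency false in
/-- **`√m* ∈ ℚ(ζ_M)` for `m ∣ M`**, `m` odd squarefree, with Galois action `σ ↦ (a_σ/m)`: the
image of the element of `exists_sqrt_jacobi_galois` under an embedding `ℚ(ζ_m) → ℚ(ζ_M)`; it is
irrational for `m ≠ 1`. [folklore] -/
theorem exists_sqrt_jacobi_galois_of_dvd (hd : m ∣ M) (hodd : Odd m) (hsq : Squarefree m) :
    ∃ θ : CyclotomicField M ℚ, θ ^ 2 = (J(-1 | m) : CyclotomicField M ℚ) * m ∧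
      (m ≠ 1 → θ ∉ Set.range (algebraMap ℚ (CyclotomicField M ℚ))) ∧
      ∀ σ : CyclotomicField M ℚ ≃ₐ[ℚ] CyclotomicField M ℚ,
        σ θ = (J((((autEquivPow (CyclotomicField M ℚ) (cyclotomic.irreducible_rat (NeZero.pos M))
          σ : (ZMod M)ˣ) : ZMod M).val : ℤ) | m) : CyclotomicField M ℚ) * θ := by
  obtain ⟨ι⟩ := nonempty_algHom_cyclotomicField_of_dvd hd
  obtain ⟨θ, hθ2, hθσ⟩ := exists_sqrt_jacobi_galois (m := m) hodd hsq
  letI : Algebra (CyclotomicField m ℚ) (CyclotomicField M ℚ) := ι.toRingHom.toAlgebra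
  haveI : IsScalarTower ℚ (CyclotomicField m ℚ) (CyclotomicField M ℚ) :=
    IsScalarTower.of_algebraMap_eq fun x => (ι.commutes x).symm
  haveI : IsGalois ℚ (CyclotomicField m ℚ) := IsCyclotomicExtension.isGalois {m} ℚ _
  refine ⟨ι θ, ?_, ?_, ?_⟩
  · rw [← map_pow, hθ2, map_mul, map_intCast, map_natCast]
  · intro hm1
    have hθ0 : θ ≠ 0 := fun h0 => by
      rw [h0, zero_pow two_ne_zero, eq_comm, mul_eq_zero, Int.cast_eq_zero, Nat.cast_eq_zero] at hθ2
      rcases hθ2 with h | h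
      · have h' : J(-1 | m) ≠ 0 := by
          rw [Ne, jacobiSym.eq_zero_iff_not_coprime, not_not]
          simp
        exact h' h
      · exact NeZero.ne m h
    rintro ⟨q, hq⟩
    exact not_mem_range_of_jacobi_galois hodd hsq hm1 hθ0 hθσ
      ⟨q, ι.injective ((ι.commutes q).trans hq)⟩
  · intro σ
    have hres : ι ((σ.restrictNormal (CyclotomicField m ℚ)) θ) = σ (ι θ) :=
      AlgEquiv.restrictNormal_commutes σ (CyclotomicField m ℚ) θ
    rw [← hres, hθσ, map_mul, map_intCast, jacobiSym_autEquivPow_restrictNormal hd ι σ]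

set_option backward.isDefEq.respectTransparency false in
/-- **Kato's Cor. 14.3 (2) over `ℚ(ζ_M)` at every quadratic character of odd squarefree
conductor, from bsd.S20 for the twist.** Assume `kato_finite_of_L_one_ne_zero V p` for every
elliptic `V/ℚ` and prime `p`. Let `E/ℚ` be elliptic with newform `f`, `m ∣ M`, `m ≠ 1` odd and
squarefree with `E` of good reduction at the primes of `m`, and `χ̃ = changeLevel (·/m)` the
Dirichlet character mod `M` induced by the Jacobi character mod `m` (i.e. ANY quadratic character
mod `M` whose primitive character has odd conductor `m`). If the mod-`M` series `∑ χ̃(n) aₙ n⁻ˢ`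
has an entire continuation non-vanishing at `1`, then `E(ℚ(ζ_M))^(χ̃)` is finite: the mod-`m`
series inherits the hypothesis (`exists_continuation_of_changeLevel`), `E^{(m*)}(ℚ)` is finite
(`finite_point_quadraticTwist_of_twistedLValue_ne_zero`), and `E(ℚ(ζ_M))^(χ̃) ↪ E^{(m*)}(ℚ)`
through `√m* ∈ ℚ(ζ_M)` (`exists_sqrt_jacobi_galois_of_dvd`, `finite_chiPart_of_finite_quadraticTwist`,
the character being `σ ↦ (a_σ/m)` by `cyclotomicCharacterOf_changeLevel_eq_restrictNormal`).
[cite: Kato2004Asterisque, Cor. 14.3 (2) (p. 235)] -/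
theorem kato_finite_chiPart_changeLevel_jacobiChar_of_kato_finite_of_L_one_ne_zero
    (hS20 : ∀ (V : WeierstrassCurve ℚ) [V.IsElliptic] (p : ℕ) [Fact p.Prime],
      kato_finite_of_L_one_ne_zero V p)
    (W : WeierstrassCurve ℚ) [W.IsElliptic] {N : ℕ} [NeZero N] {f : CuspForm (Gamma0 N) 2}
    (hf : IsNewformOf W f) [DecidableEq (CyclotomicField M ℚ)] (hd : m ∣ M) (hodd : Odd m)
    (hsq : Squarefree m) (hm1 : m ≠ 1)
    (hgood : ∀ v : HeightOneSpectrum (𝓞 ℚ), (primesEquiv v : ℕ) ∣ m → W.HasGoodReductionAt v)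
    (hL : ∃ L : ℂ → ℂ, Differentiable ℂ L ∧
      (∀ s : ℂ, 2 < s.re →
        L s = twistedLSeries f (DirichletCharacter.changeLevel hd (jacobiChar m)) s) ∧ L 1 ≠ 0) :
    Finite (chiPart
      (fun σ : CyclotomicField M ℚ ≃ₐ[ℚ] CyclotomicField M ℚ =>
        Point.map (W' := W.toAffine) (σ : CyclotomicField M ℚ →ₐ[ℚ] CyclotomicField M ℚ))
      (fun σ => (cyclotomicCharacterOf (DirichletCharacter.changeLevel hd (jacobiChar m)) σ : ℂ))) := by
  -- finiteness of `E^{(m*)}(ℚ)` from the mod-`m` hypothesis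
  have hfin := finite_point_quadraticTwist_of_twistedLValue_ne_zero hS20 W hf hodd hsq hgood
    (exists_continuation_of_changeLevel hf.1 hd (jacobiChar m) hL)
  -- `√m* ∈ ℚ(ζ_M)`
  obtain ⟨θ, hθ2, hθnot, hθσ⟩ := exists_sqrt_jacobi_galois_of_dvd hd hodd hsq
  have hd' : θ ^ 2 = algebraMap ℚ (CyclotomicField M ℚ) ((J(-1 | m) * m : ℤ) : ℚ) := by
    rw [hθ2, Int.cast_mul, map_mul, map_intCast, Int.cast_natCast, map_natCast]
  -- the character `σ ↦ (a_σ/m)`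
  obtain ⟨ι⟩ := nonempty_algHom_cyclotomicField_of_dvd hd
  have hχ : ∀ σ : CyclotomicField M ℚ ≃ₐ[ℚ] CyclotomicField M ℚ,
      (cyclotomicCharacterOf (DirichletCharacter.changeLevel hd (jacobiChar m)) σ : ℂ) =
        (J((((autEquivPow (CyclotomicField M ℚ) (cyclotomic.irreducible_rat (NeZero.pos M)) σ :
          (ZMod M)ˣ) : ZMod M).val : ℤ) | m) : ℂ) := fun σ => by
    letI : Algebra (CyclotomicField m ℚ) (CyclotomicField M ℚ) := ι.toRingHom.toAlgebra
    haveI : IsScalarTower ℚ (CyclotomicField m ℚ) (CyclotomicField M ℚ) :=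
      IsScalarTower.of_algebraMap_eq fun x => (ι.commutes x).symm
    haveI : IsGalois ℚ (CyclotomicField m ℚ) := IsCyclotomicExtension.isGalois {m} ℚ _
    have h := cyclotomicCharacterOf_changeLevel_eq_restrictNormal hd ι σ (jacobiChar m)
    rw [h, coe_cyclotomicCharacterOf_jacobiChar, jacobiSym_autEquivPow_restrictNormal hd ι σ]
  have hc : ∀ σ : CyclotomicField M ℚ ≃ₐ[ℚ] CyclotomicField M ℚ,
      J((((autEquivPow (CyclotomicField M ℚ) (cyclotomic.irreducible_rat (NeZero.pos M)) σ :
          (ZMod M)ˣ) : ZMod M).val : ℤ) | m) = 1 ∨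
      J((((autEquivPow (CyclotomicField M ℚ) (cyclotomic.irreducible_rat (NeZero.pos M)) σ :
          (ZMod M)ˣ) : ZMod M).val : ℤ) | m) = -1 := fun σ => by
    have h0 : J((((autEquivPow (CyclotomicField M ℚ) (cyclotomic.irreducible_rat (NeZero.pos M))
        σ : (ZMod M)ˣ) : ZMod M).val : ℤ) | m) ≠ 0 := by
      rw [Ne, jacobiSym.eq_zero_iff_not_coprime, not_not, Int.gcd_natCast_natCast]
      exact (coprime_val_autEquivPow σ).coprime_dvd_right hd
    rcases jacobiSym.trichotomy ((((autEquivPow (CyclotomicField M ℚ)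
        (cyclotomic.irreducible_rat (NeZero.pos M)) σ : (ZMod M)ˣ) : ZMod M).val : ℤ)) m with
      h | h | h
    · exact (h0 h).elim
    · exact Or.inl h
    · exact Or.inr h
  exact finite_chiPart_of_finite_quadraticTwist W (hθnot hm1) hd' hc hθσ hχ hfin

end Inflation

end Literature.NumberTheory.EllipticCurves

end
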